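/-
COR-CM (cell pub-hodgecm2, stage 2 of the Hodge ladder) — count-neutral KERNEL COMBINATORICS «the binary tetrahedral group SL(2,3)», part I: the datum
(seat prover-pub-hodgecm2-b23-g53-0, binder prover b23, gen 53; claim «SYLOW TRANSFER XIII–XIV — the order-8p assembly», HOME/INBOX.md l.24246, NAME ASK
l.24300).  One structure (`Datum`) + theorems, on top of seat b09ʼs intrinsic model and lit-andre-3ʼs type-stabiliser theory (consumed BY NAME in the
sequels); no `decide`, no certificate, no named fact, no `sorry`; `Interfaces.lean` (C1), every E term, B01, `Transposition/*`, `PortJoin/*`, `D2Bridge/*`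
untouched.  HONEST FRAMING: `HC_CM` is NOT proved, here or anywhere in the tree; nothing here is a period, a count of record or a headline.
T5: n/a-class (hypothesis binders = the fields of `BinaryTetrahedral.Datum`; inhabited by `SL(2,𝔽₃)` with `c = −1`, `i = [[0,−1],[1,0]]`,
`j = [[1,1],[1,−1]]`, `a = [[1,1],[0,1]]`-type elements; checker: self).
-/
import Summits.HodgeConjecture.CorCM.Census.SylowTransferShearedElements

/-!
# The binary tetrahedral group, I: the datum `SL(2,3) = Q₈ ⋊ ℤ/3 = ⟨i, j, a | i² = j² = c, j i j⁻¹ = i⁻¹, a³ = 1, a i a⁻¹ = j, a j a⁻¹ = ij⟩`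

After this seatʼs parts XIII/XIV (`Census/SylowTransferShearedElements.lean`, `Census/SylowTransferEightPrimeAll.lean`) every group of order `8p` (`p` an
odd prime) with a central involution `c` has `μ(G, c) = φ₂(G, c)` EXCEPT possibly when `p = 3` and the Sylow `3`-subgroup is not normal — and then (part
III, `Census/BinaryTetrahedralDichotomy.lean`) `G` carries the datum of this file: the quaternion units `i, j` (squares `c`, `j` inverts `i`) inside a
subgroup `Q` of order `8`, and an element `a` of order `3` cycling `i ↦ j ↦ ij`; `|G| = 24`.  Then `G ≅ SL(2,3)` (the binary tetrahedral group `2T`),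
`c = −1 ∈ [G,G]`, no subgroup of index two, `β = 176`, `φ₂ = 174` — the LAST open row of order `24` (and of order `8p`).
THIS FILE: the structure `Datum` (§1); the relations (§2: `c` central of order two, `k := ij`, `a k a⁻¹ = i`, the squares); the quaternion subgroup
`Q = {iᵘ jᵛ}` (§3); the NORMAL FORM `iᵘ jᵛ aᵉ` (`u < 4`, `v < 2`, `e < 3`), `exhaust`, `hcen` (§4); **`𝒦(G, c) = G`** (generated by the elements `a`,
`i a²` of order `3`) and **`β = φ₂ + 2`** (§5).  Part II (`Census/BinaryTetrahedralFloor.lean`): the floor `μ ≥ β − 2 = φ₂`.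
All [folklore] bookkeeping over [Pohlmann1968, Thm 1] in the reading of [Milne1999, Prop. 2.1].

## References
* [Pohlmann1968] H. Pohlmann, Algebraic cycles on abelian varieties of complex multiplication type, Ann. of Math. 88 (1968), Thm 1.
* [Milne1999] J. S. Milne, Lefschetz motives and the Tate conjecture, Compositio Math. 117 (1999), Prop. 2.1, p. 54.
-/

namespace Summit.HodgeConjecture.CorCM.Census.BinaryTetrahedral

open Finset
open Summit.HodgeConjecture.CorCM.Prior.AllgGroup.RfwfAllgGroup
open Summit.HodgeConjecture.CorCM.Census.BlockParity
open Summit.HodgeConjecture.CorCM.Census.Coinvariant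
open Summit.HodgeConjecture.CorCM.Census.TypeStabiliser

noncomputable section

variable {G : Type*} [Group G] [Fintype G] [DecidableEq G] {c : G}

/-! ## §1 The binary tetrahedral datum -/

/-- **A binary tetrahedral datum for `(G, c)`**: quaternion units `i, j` with `i² = j² = c`, `j i j⁻¹ = i⁻¹`, `j ∉ ⟨i⟩`, inside a subgroup `Q` of order
`8`, and an element `a` of order `3` with `a i a⁻¹ = j`, `a j a⁻¹ = ij`, in a group of order `24`.  Then `G ≅ SL(2,3)`, `c = −1`. [folklore] -/
structure Datum (G : Type*) [Group G] (c : G) where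
  /-- the quaternion unit `i` -/
  i : G
  /-- the quaternion unit `j` -/
  j : G
  /-- the element of order `3` -/
  a : G
  /-- the quaternion subgroup -/
  Q : Subgroup G
  /-- `i` has order `4` -/
  hord_i : orderOf i = 4
  /-- `i² = c` -/
  hii : i * i = c
  /-- `j² = c` -/
  hjj : j * j = c
  /-- `j` inverts `i` -/
  hji : j * i * j⁻¹ = i⁻¹
  /-- `j ∉ ⟨i⟩` -/
  hj : j ∉ Subgroup.zpowers i
  /-- `i ∈ Q` -/
  hiQ : i ∈ Q
  /-- `j ∈ Q` -/
  hjQ : j ∈ Q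
  /-- `|Q| = 8` -/
  hQ : Nat.card Q = 8
  /-- `a` has order `3` -/
  hord_a : orderOf a = 3
  /-- `a i a⁻¹ = j` -/
  hai : a * i * a⁻¹ = j
  /-- `a j a⁻¹ = i j` -/
  haj : a * j * a⁻¹ = i * j
  /-- `|G| = 24` -/
  hcard : Nat.card G = 24

variable (D : Datum G c)

namespace Datum

include D

/-! ## §2 Relations -/

omit [Fintype G] [DecidableEq G] in
/-- `i⁴ = 1`. [folklore] -/
theorem i_pow_four : D.i ^ 4 = 1 := by rw [← D.hord_i, pow_orderOf_eq_one]

omit [Fintype G] [DecidableEq G] in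
/-- `c·c = 1`. [folklore] -/
theorem c_mul_c : c * c = 1 := by
  rw [← D.hii, show D.i * D.i * (D.i * D.i) = D.i ^ 4 by simp only [pow_succ, pow_zero, one_mul, mul_assoc], D.i_pow_four]

omit [Fintype G] [DecidableEq G] in
/-- `c⁻¹ = c`. [folklore] -/
theorem c_inv : c⁻¹ = c := inv_eq_of_mul_eq_one_right D.c_mul_c

omit [Fintype G] [DecidableEq G] in
/-- `c ≠ 1` (`i` has order `4`, not `2`). [folklore] -/
theorem c_ne_one : c ≠ 1 := by
  intro h
  have h2 : D.i ^ 2 = 1 := by rw [pow_two, D.hii, h]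
  have := orderOf_dvd_of_pow_eq_one h2
  rw [D.hord_i] at this
  omega

omit [Fintype G] [DecidableEq G] in
/-- `c` has order `2`. [folklore] -/
theorem orderOf_c : orderOf c = 2 := by
  haveI : Fact (Nat.Prime 2) := ⟨Nat.prime_two⟩
  exact orderOf_eq_prime (by rw [pow_two, D.c_mul_c]) D.c_ne_one

omit [Fintype G] [DecidableEq G] in
/-- `i⁻¹ = c i`. [folklore] -/
theorem i_inv : D.i⁻¹ = c * D.i := by
  apply inv_eq_of_mul_eq_one_right
  calc D.i * (c * D.i) = D.i * (D.i * D.i * D.i) := by rw [D.hii]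
    _ = D.i ^ 4 := by simp only [pow_succ, pow_zero, one_mul, mul_assoc]
    _ = 1 := D.i_pow_four

omit [Fintype G] [DecidableEq G] in
/-- `j⁻¹ = c j`. [folklore] -/
theorem j_inv : D.j⁻¹ = c * D.j := by
  apply inv_eq_of_mul_eq_one_right
  calc D.j * (c * D.j) = D.j * (D.j * D.j * D.j) := by rw [D.hjj]
    _ = (D.j * D.j) * (D.j * D.j) := by group
    _ = 1 := by rw [D.hjj, D.c_mul_c]

omit [Fintype G] [DecidableEq G] in
/-- `i` commutes with `c = i²`. [folklore] -/
theorem commute_i_c : Commute D.i c := by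
  show D.i * c = c * D.i
  calc D.i * c = D.i * (D.i * D.i) := by rw [D.hii]
    _ = (D.i * D.i) * D.i := by group
    _ = c * D.i := by rw [D.hii]

omit [Fintype G] [DecidableEq G] in
/-- `j` commutes with `c = j²`. [folklore] -/
theorem commute_j_c : Commute D.j c := by
  show D.j * c = c * D.j
  calc D.j * c = D.j * (D.j * D.j) := by rw [D.hjj]
    _ = (D.j * D.j) * D.j := by group
    _ = c * D.j := by rw [D.hjj]

omit [Fintype G] [DecidableEq G] in
/-- `a` commutes with `c` (`a c a⁻¹ = (a i a⁻¹)² = j² = c`). [folklore] -/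
theorem commute_a_c : Commute D.a c := by
  have h : D.a * c * D.a⁻¹ = c := by
    calc D.a * c * D.a⁻¹ = (D.a * D.i * D.a⁻¹) * (D.a * D.i * D.a⁻¹) := by
          rw [show (D.a * D.i * D.a⁻¹) * (D.a * D.i * D.a⁻¹) = D.a * (D.i * D.i) * D.a⁻¹ by group, D.hii]
      _ = c := by rw [D.hai, D.hjj]
  exact mul_inv_eq_iff_eq_mul.mp h

omit [Fintype G] [DecidableEq G] in
/-- **`j i = c i j`** (the quaternion relation). [folklore] -/
theorem j_mul_i : D.j * D.i = c * D.i * D.j := by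
  calc D.j * D.i = D.j * D.i * D.j⁻¹ * D.j := by rw [inv_mul_cancel_right]
    _ = c * D.i * D.j := by rw [D.hji, D.i_inv]

omit [Fintype G] [DecidableEq G] in
/-- `j` has order `4`. [folklore] -/
theorem orderOf_j : orderOf D.j = 4 := by
  haveI : Fact (Nat.Prime 2) := ⟨Nat.prime_two⟩
  have h := orderOf_eq_prime_pow (p := 2) (n := 1) (x := D.j) (by rw [pow_one, pow_two, D.hjj]; exact D.c_ne_one)
    (by rw [show 2 ^ (1 + 1) = 2 * 2 by norm_num, pow_mul, pow_two D.j, D.hjj, pow_two, D.c_mul_c])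
  simpa using h

omit [Fintype G] [DecidableEq G] in
/-- `k := ij` has square `c`. [folklore] -/
theorem ij_mul_ij : D.i * D.j * (D.i * D.j) = c := by
  calc D.i * D.j * (D.i * D.j) = D.i * (D.j * D.i) * D.j := by group
    _ = D.i * (c * D.i * D.j) * D.j := by rw [D.j_mul_i]
    _ = (D.i * c) * D.i * (D.j * D.j) := by group
    _ = (c * D.i) * D.i * (D.j * D.j) := by rw [D.commute_i_c.eq]
    _ = c * (D.i * D.i) * (D.j * D.j) := by group
    _ = c := by rw [D.hii, D.hjj, D.c_mul_c, one_mul]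

omit [Fintype G] [DecidableEq G] in
/-- **`a (ij) a⁻¹ = i`**: `a` cycles `i ↦ j ↦ ij ↦ i`. [folklore] -/
theorem a_mul_ij : D.a * (D.i * D.j) * D.a⁻¹ = D.i := by
  calc D.a * (D.i * D.j) * D.a⁻¹ = (D.a * D.i * D.a⁻¹) * (D.a * D.j * D.a⁻¹) := by group
    _ = D.j * (D.i * D.j) := by rw [D.hai, D.haj]
    _ = (D.j * D.i) * D.j := by group
    _ = c * D.i * D.j * D.j := by rw [D.j_mul_i]
    _ = c * D.i * c := by rw [mul_assoc (c * D.i), D.hjj]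
    _ = D.i := by rw [mul_assoc, D.commute_i_c.eq, ← mul_assoc, D.c_mul_c, one_mul]

omit [Fintype G] [DecidableEq G] in
/-- `a³ = 1`. [folklore] -/
theorem a_pow_three : D.a ^ 3 = 1 := by rw [← D.hord_a, pow_orderOf_eq_one]

omit [Fintype G] [DecidableEq G] in
/-- `a⁻¹ = a²`. [folklore] -/
theorem a_inv : D.a⁻¹ = D.a ^ 2 := by
  apply inv_eq_of_mul_eq_one_right
  rw [← pow_succ', D.a_pow_three]

omit [Fintype G] [DecidableEq G] in
/-- `(a²)⁻¹ = a`. [folklore] -/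
theorem a_sq_inv : (D.a ^ 2)⁻¹ = D.a := by rw [← D.a_inv, inv_inv]

omit [Fintype G] [DecidableEq G] in
/-- `a ≠ 1`. [folklore] -/
theorem a_ne_one : D.a ≠ 1 := fun h => by
  have := D.hord_a; rw [h, orderOf_one] at this; omega

omit [Fintype G] [DecidableEq G] in
/-- `a² ≠ 1`. [folklore] -/
theorem a_sq_ne_one : D.a ^ 2 ≠ 1 := fun h => by
  have := orderOf_dvd_of_pow_eq_one h; rw [D.hord_a] at this; omega

omit [Fintype G] [DecidableEq G] in
/-- `a² i a⁻² = ij`. [folklore] -/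
theorem a_sq_mul_i : D.a ^ 2 * D.i * (D.a ^ 2)⁻¹ = D.i * D.j := by
  calc D.a ^ 2 * D.i * (D.a ^ 2)⁻¹ = D.a * (D.a * D.i * D.a⁻¹) * D.a⁻¹ := by rw [pow_two]; group
    _ = D.i * D.j := by rw [D.hai, D.haj]

omit [Fintype G] [DecidableEq G] in
/-- `a² j a⁻² = i`. [folklore] -/
theorem a_sq_mul_j : D.a ^ 2 * D.j * (D.a ^ 2)⁻¹ = D.i := by
  calc D.a ^ 2 * D.j * (D.a ^ 2)⁻¹ = D.a * (D.a * D.j * D.a⁻¹) * D.a⁻¹ := by rw [pow_two]; group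
    _ = D.i := by rw [D.haj, D.a_mul_ij]

omit [Fintype G] [DecidableEq G] in
/-- **`(i a²)³ = 1`**: `i a² · i a² · i a² = i·(ij)·a⁴·i·a² = c j (a i) a² = c j j a³ = c·c`. [folklore] -/
theorem i_mul_a_sq_pow_three : (D.i * D.a ^ 2) ^ 3 = 1 := by
  have h1 : D.a ^ 2 * D.i = D.i * D.j * D.a ^ 2 := by
    calc D.a ^ 2 * D.i = D.a ^ 2 * D.i * (D.a ^ 2)⁻¹ * D.a ^ 2 := by rw [inv_mul_cancel_right]
      _ = D.i * D.j * D.a ^ 2 := by rw [D.a_sq_mul_i]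
  have h2 : D.a ^ 2 * D.a ^ 2 = D.a := by
    rw [← pow_add, show 2 + 2 = 3 + 1 by norm_num, pow_add, D.a_pow_three, one_mul, pow_one]
  have h3 : D.a * D.i = D.j * D.a := by rw [← D.hai, inv_mul_cancel_right]
  calc (D.i * D.a ^ 2) ^ 3 = D.i * (D.a ^ 2 * D.i) * D.a ^ 2 * (D.i * D.a ^ 2) := by rw [pow_succ, pow_two]; group
    _ = D.i * (D.i * D.j * D.a ^ 2) * D.a ^ 2 * (D.i * D.a ^ 2) := by rw [h1]
    _ = (D.i * D.i) * D.j * (D.a ^ 2 * D.a ^ 2) * D.i * D.a ^ 2 := by group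
    _ = c * D.j * D.a * D.i * D.a ^ 2 := by rw [D.hii, h2]
    _ = c * D.j * (D.a * D.i) * D.a ^ 2 := by group
    _ = c * D.j * (D.j * D.a) * D.a ^ 2 := by rw [h3]
    _ = c * (D.j * D.j) * (D.a * D.a ^ 2) := by group
    _ = c * c * D.a ^ 3 := by rw [D.hjj, ← pow_succ']
    _ = 1 := by rw [D.a_pow_three, mul_one, D.c_mul_c]

omit [Fintype G] [DecidableEq G] in
/-- `i a²` has order `3`. [folklore] -/
theorem orderOf_i_mul_a_sq : orderOf (D.i * D.a ^ 2) = 3 := by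
  haveI : Fact (Nat.Prime 3) := ⟨Nat.prime_three⟩
  refine orderOf_eq_prime D.i_mul_a_sq_pow_three fun h => ?_
  -- `i a² = 1` would give `i = a`, of order `3 ≠ 4`
  have hi : D.i = D.a := by
    calc D.i = D.i * D.a ^ 2 * (D.a ^ 2)⁻¹ := by rw [mul_inv_cancel_right]
      _ = D.a := by rw [h, one_mul, D.a_sq_inv]
  have := D.hord_i
  rw [hi, D.hord_a] at this
  omega

/-! ## §3 The quaternion subgroup `Q = {iᵘ jᵛ}` -/

omit [Fintype G] [DecidableEq G] in
/-- The words `iᵘ jᵛ` lie in `Q`. [folklore] -/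
theorem word_mem_Q (u v : ℕ) : D.i ^ u * D.j ^ v ∈ D.Q := mul_mem (D.Q.pow_mem D.hiQ u) (D.Q.pow_mem D.hjQ v)

omit [Fintype G] [DecidableEq G] in
/-- `c ∈ Q`. [folklore] -/
theorem c_mem_Q : c ∈ D.Q := by
  have h : D.i * D.i ∈ D.Q := mul_mem D.hiQ D.hiQ
  rwa [D.hii] at h

omit [Fintype G] [DecidableEq G] in
/-- **The words `iᵘ jᵛ` (`u < 4`, `v < 2`) are distinct.** [folklore] -/
theorem word_inj {u v u' v' : ℕ} (hu : u < 4) (hu' : u' < 4) (hv : v < 2) (hv' : v' < 2)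
    (h : D.i ^ u * D.j ^ v = D.i ^ u' * D.j ^ v') : u = u' ∧ v = v' := by
  have hvv : v = v' := by
    by_contra hne
    have key : ∀ {x y : ℕ}, D.i ^ x * D.j = D.i ^ y → False := fun {x y} hxy =>
      D.hj (by
        have : D.j = (D.i ^ x)⁻¹ * D.i ^ y := by rw [← hxy, inv_mul_cancel_left]
        rw [this]
        exact mul_mem (inv_mem (Subgroup.pow_mem _ (Subgroup.mem_zpowers _) _)) (Subgroup.pow_mem _ (Subgroup.mem_zpowers _) _))
    interval_cases v <;> interval_cases v'
    · exact hne rfl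
    · rw [pow_zero, mul_one, pow_one] at h; exact key h.symm
    · rw [pow_zero, mul_one, pow_one] at h; exact key h
    · exact hne rfl
  subst hvv
  refine ⟨?_, rfl⟩
  have h' : D.i ^ u = D.i ^ u' := mul_right_cancel h
  have := pow_inj_mod.mp h'
  rwa [D.hord_i, Nat.mod_eq_of_lt hu, Nat.mod_eq_of_lt hu'] at this

omit [DecidableEq G] in
/-- **`Q = {iᵘ jᵛ : u < 4, v < 2}`**: every element of `Q` is a word (eight distinct words in a subgroup of order `8`). [folklore] -/
theorem exists_word_of_mem_Q {q : G} (hq : q ∈ D.Q) : ∃ u : ℕ, u < 4 ∧ ∃ v : ℕ, v < 2 ∧ q = D.i ^ u * D.j ^ v := by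
  classical
  let f : Fin 4 × Fin 2 → D.Q := fun t => ⟨D.i ^ (t.1 : ℕ) * D.j ^ (t.2 : ℕ), D.word_mem_Q _ _⟩
  have hinj : Function.Injective f := by
    rintro ⟨u, v⟩ ⟨u', v'⟩ h
    obtain ⟨h1, h2⟩ := D.word_inj u.2 u'.2 v.2 v'.2 (congrArg Subtype.val h)
    ext <;> simp only [h1, h2]
  haveI : Fintype D.Q := Fintype.ofFinite _
  have hcard : Fintype.card (Fin 4 × Fin 2) = Fintype.card D.Q := by
    rw [← Nat.card_eq_fintype_card (α := D.Q), D.hQ]; simp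
  have hbij : Function.Bijective f := (Fintype.bijective_iff_injective_and_card f).mpr ⟨hinj, hcard⟩
  obtain ⟨⟨u, v⟩, huv⟩ := hbij.2 ⟨q, hq⟩
  exact ⟨u, u.2, v, v.2, by have := congrArg Subtype.val huv; exact this.symm⟩

omit [Fintype G] [DecidableEq G] in
/-- Elements of `Q` have order dividing `8`. [folklore] -/
theorem orderOf_dvd_eight_of_mem_Q {q : G} (hq : q ∈ D.Q) : orderOf q ∣ 8 := D.hQ ▸ D.Q.orderOf_dvd_natCard hq

omit [Fintype G] [DecidableEq G] in
/-- **`a ∉ Q` and `a² ∉ Q`** (elements of order `3`). [folklore] -/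
theorem a_pow_notMem_Q : D.a ∉ D.Q ∧ D.a ^ 2 ∉ D.Q := by
  have key : ∀ {x : G}, orderOf x = 3 → x ∉ D.Q := fun {x} hx hxQ => by
    have h : orderOf x ∣ 8 := D.orderOf_dvd_eight_of_mem_Q hxQ
    rw [hx] at h
    norm_num at h
  refine ⟨key D.hord_a, key ?_⟩
  rw [orderOf_pow' D.a (by norm_num), D.hord_a]
  decide

/-! ## §4 The normal form `iᵘ jᵛ aᵉ` -/

omit [Fintype G] [DecidableEq G] in
/-- **The normal form is injective**: the elements `iᵘ jᵛ aᵉ` (`u < 4`, `v < 2`, `e < 3`) are pairwise distinct. [folklore] -/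
theorem normalForm_inj {u v e u' v' e' : ℕ} (hu : u < 4) (hu' : u' < 4) (hv : v < 2) (hv' : v' < 2) (he : e < 3) (he' : e' < 3)
    (h : D.i ^ u * D.j ^ v * D.a ^ e = D.i ^ u' * D.j ^ v' * D.a ^ e') : u = u' ∧ v = v' ∧ e = e' := by
  -- `aᵉ (aᵉ')⁻¹ ∈ Q`
  have hmem : D.a ^ e * (D.a ^ e')⁻¹ ∈ D.Q := by
    have : D.a ^ e * (D.a ^ e')⁻¹ = (D.i ^ u * D.j ^ v)⁻¹ * (D.i ^ u' * D.j ^ v') := by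
      rw [mul_inv_eq_iff_eq_mul, mul_assoc, ← h, inv_mul_cancel_left]
    rw [this]
    exact mul_mem (inv_mem (D.word_mem_Q u v)) (D.word_mem_Q u' v')
  obtain ⟨ha1, ha2⟩ := D.a_pow_notMem_Q
  have hee : e = e' := by
    by_contra hne
    interval_cases e <;> interval_cases e'
    · exact hne rfl
    · rw [pow_zero, one_mul, pow_one, D.a_inv] at hmem; exact ha2 hmem
    · rw [pow_zero, one_mul, D.a_sq_inv] at hmem; exact ha1 hmem
    · rw [pow_one, pow_zero, inv_one, mul_one] at hmem; exact ha1 hmem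
    · exact hne rfl
    · rw [pow_one, D.a_sq_inv, ← pow_two] at hmem; exact ha2 hmem
    · rw [pow_zero, inv_one, mul_one] at hmem; exact ha2 hmem
    · rw [pow_one, D.a_inv, ← pow_add, show 2 + 2 = 3 + 1 by norm_num, pow_add, D.a_pow_three, one_mul, pow_one] at hmem
      exact ha1 hmem
    · exact hne rfl
  subst hee
  obtain ⟨h1, h2⟩ := D.word_inj hu hu' hv hv' (mul_right_cancel h)
  exact ⟨h1, h2, rfl⟩

omit [DecidableEq G] in
/-- **`|G| = 24`** as a `Fintype.card`. [folklore] -/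
theorem card_eq : Fintype.card G = 24 := by rw [← Nat.card_eq_fintype_card, D.hcard]

omit [DecidableEq G] in
/-- **EXHAUSTION: every element is `iᵘ jᵛ aᵉ`** with `u < 4`, `v < 2`, `e < 3` (the `24` normal forms are distinct in a group of order `24`).
[folklore] -/
theorem exhaust (y : G) : ∃ u : ℕ, u < 4 ∧ ∃ v : ℕ, v < 2 ∧ ∃ e : ℕ, e < 3 ∧ y = D.i ^ u * D.j ^ v * D.a ^ e := by
  classical
  let f : Fin 4 × Fin 2 × Fin 3 → G := fun t => D.i ^ (t.1 : ℕ) * D.j ^ (t.2.1 : ℕ) * D.a ^ (t.2.2 : ℕ)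
  have hinj : Function.Injective f := by
    rintro ⟨u, v, e⟩ ⟨u', v', e'⟩ h
    obtain ⟨h1, h2, h3⟩ := D.normalForm_inj u.2 u'.2 v.2 v'.2 e.2 e'.2 h
    ext <;> simp only [h1, h2, h3]
  have hcard : Fintype.card (Fin 4 × Fin 2 × Fin 3) = Fintype.card G := by rw [D.card_eq]; simp
  have hbij : Function.Bijective f := (Fintype.bijective_iff_injective_and_card f).mpr ⟨hinj, hcard⟩
  obtain ⟨⟨u, v, e⟩, rfl⟩ := hbij.2 y
  exact ⟨u, u.2, v, v.2, e, e.2, rfl⟩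

omit [DecidableEq G] in
/-- **`c` is central.** [folklore] -/
theorem hcen : ∀ y : G, y * c = c * y := by
  intro y
  obtain ⟨u, -, v, -, e, -, rfl⟩ := D.exhaust y
  exact (((D.commute_i_c.pow_left u).mul_left (D.commute_j_c.pow_left v)).mul_left (D.commute_a_c.pow_left e)).eq

end Datum

end

end Summit.HodgeConjecture.CorCM.Census.BinaryTetrahedral
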